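import Mathlib
import Literature.NumberTheory.Transcendental.SiegelWrapper
import Literature.NumberTheory.Transcendental.SixExponentialsPadicProofs
import Literature.NumberTheory.Transcendental.AuxiliaryPolynomialBookkeeping

/-!
# Transcendence core of line `Sketch` for crux `IntegralOverconvergentIsCongruence`

Stub `stub_auxPoly` of `Summits/Langlands/Langlands/Cruxes/IntegralOverconvergentIsCongruence/Lines/Sketch.lean`
(item stmt-Langlands-8457, route `CapacityClassicality`): the one-variable auxiliary-polynomial
argument (Siegel's lemma over `𝓞_E` + trivial archimedean coefficient estimates at every complex
embedding + the `𝔭`-adic Liouville inequality through `N_{E/ℚ}`) showing that a `v`-adic GAIN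
`‖v(a_M(F_P))‖ ≤ A·B^{D₁+D₂}·R^{-M}` (`R > 1`) on the leading coefficient of every auxiliary form
`F_P = Σ P_{ij} x₁ⁱ x₂^{D₁-i} (g¹² x₂^{k₂})ʲ (x₂^{k₁})^{D₂-j}` forces a non-trivial relation `F_P = 0`.
The elementary bookkeeping (weighted coefficient sums, integrality, growth lemma) lives in
`Literature.NumberTheory.Transcendental.AuxiliaryPolynomialBookkeeping`.
-/

open scoped BigOperators
open Finset PowerSeries NumberField
open Literature.NumberTheory.Transcendental

set_option linter.dupNamespace false -- project-wide option (lakefile weak.linter.dupNamespace); `Summit.Langlands.Langlands` is the mandated namespace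

noncomputable section

namespace Summit.Langlands.Langlands.Theorems.CapacityClassicality

/-! ## § 4 The transcendence core -/

/-- **Transcendence core (auxiliary polynomial).** Over a number field `E` with a `p`-adic embedding
`v`, let `x₁, x₂, g ∈ E⟦q⟧` have algebraic-integer coefficients and radius of convergence `≥ 1`
under every complex embedding. If every auxiliary combination
`F_P = Σ P_{ij} x₁ⁱ x₂^{D₁-i} (g¹² x₂^{k₂})ʲ (x₂^{k₁})^{D₂-j}` with `P_{ij} ∈ 𝓞_E` enjoys the `v`-adic
gain `‖v(a_M(F_P))‖ ≤ A B^{D₁+D₂} R^{-M}` at its vanishing order `M` (`R > 1`), then some `P ≠ 0`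
has `F_P = 0`.

Proof: suppose not. Fix `D` large (growth lemma `exists_poly_mul_exp_lt_exp_sq`) and solve, by
Siegel's lemma over `𝓞_E` (`siegel_house`), the `⌊(D+1)²/2⌋` linear equations "`a_m(F_P) = 0`,
`m < ⌊(D+1)²/2⌋`" in the `(D+1)²` unknowns `P_{ij} ∈ 𝓞_E`; the coefficient matrix has house
`≤ Λ^D s^{m}` by the trivial weighted-sum estimates of § 1 at radius `ρ = s⁻¹`, `s = R^{1/4d}`. The
leading coefficient `α = a_{M'}(F_P) ≠ 0`, `M' ≥ ⌊(D+1)²/2⌋`, is an algebraic integer with all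
conjugates `≤ C² (D+1)⁴ Λ^{2D} s^{2M'}`, so the `𝔭`-adic Liouville inequality
(`SixExpPadic.liouville_padic`) and the gain give `s^{4dM'} = R^{M'} ≤ A B^{2D} (…)^d s^{2dM'}`, i.e.
`s^{D²} ≤ A C^{2d} (D+1)^{4d} (B²Λ^{2d})^D`, contradicting the choice of `D`. -/
theorem stub_auxPoly (E : Type) [Field E] [NumberField E] (p : ℕ) [Fact p.Prime]
    (v : E →+* PadicAlgCl p) (x₁ x₂ g : PowerSeries E) (k₁ k₂ : ℕ)
    (hx₁ : ∀ n, IsIntegral ℤ (coeff n x₁)) (hx₂ : ∀ n, IsIntegral ℤ (coeff n x₂))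
    (hg : ∀ n, IsIntegral ℤ (coeff n g))
    (hrx₁ : ∀ (σ : E →+* ℂ) (t : ℝ), 0 < t → t < 1 → ∃ K : ℝ, ∀ n, ‖σ (coeff n x₁)‖ * t ^ n ≤ K)
    (hrx₂ : ∀ (σ : E →+* ℂ) (t : ℝ), 0 < t → t < 1 → ∃ K : ℝ, ∀ n, ‖σ (coeff n x₂)‖ * t ^ n ≤ K)
    (hrg : ∀ (σ : E →+* ℂ) (t : ℝ), 0 < t → t < 1 → ∃ K : ℝ, ∀ n, ‖σ (coeff n g)‖ * t ^ n ≤ K)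
    (A B R : ℝ) (hA : 0 < A) (hB : 1 ≤ B) (hR : 1 < R)
    (hgain : ∀ (D₁ D₂ : ℕ) (P : Fin (D₁ + 1) → Fin (D₂ + 1) → E),
      (∀ i j, IsIntegral ℤ (P i j)) → ∀ M : ℕ,
        (∀ m, m < M → coeff m (∑ i : Fin (D₁ + 1), ∑ j : Fin (D₂ + 1),
          PowerSeries.C (P i j) * x₁ ^ (i : ℕ) * x₂ ^ (D₁ - i) * (g ^ 12 * x₂ ^ k₂) ^ (j : ℕ) *
            (x₂ ^ k₁) ^ (D₂ - j)) = 0) →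
        ‖v (coeff M (∑ i : Fin (D₁ + 1), ∑ j : Fin (D₂ + 1),
          PowerSeries.C (P i j) * x₁ ^ (i : ℕ) * x₂ ^ (D₁ - i) * (g ^ 12 * x₂ ^ k₂) ^ (j : ℕ) *
            (x₂ ^ k₁) ^ (D₂ - j)))‖ ≤ A * B ^ (D₁ + D₂) * R⁻¹ ^ M) :
    ∃ (D₁ D₂ : ℕ) (P : Fin (D₁ + 1) → Fin (D₂ + 1) → E), P ≠ 0 ∧
      (∑ i : Fin (D₁ + 1), ∑ j : Fin (D₂ + 1),
          PowerSeries.C (P i j) * x₁ ^ (i : ℕ) * x₂ ^ (D₁ - i) * (g ^ 12 * x₂ ^ k₂) ^ (j : ℕ) *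
            (x₂ ^ k₁) ^ (D₂ - j)) = 0 := by
  classical
  by_contra H
  push Not at H
  /- ### constants independent of `D` -/
  set d : ℕ := Module.finrank ℚ E with hd_def
  have hd : 1 ≤ d := Module.finrank_pos
  have hR0 : 0 < R := zero_lt_one.trans hR
  set s : ℝ := R ^ ((1 : ℝ) / (4 * d)) with hs_def
  have hs1 : 1 < s := Real.one_lt_rpow hR (by positivity)
  have hs0 : 0 < s := zero_lt_one.trans hs1
  have hsR : s ^ (4 * d) = R := by
    rw [hs_def, ← Real.rpow_natCast, ← Real.rpow_mul hR0.le]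
    have : (1 : ℝ) / (4 * d) * ((4 * d : ℕ) : ℝ) = 1 := by
      rw [Nat.cast_mul, Nat.cast_ofNat]
      field_simp
    rw [this, Real.rpow_one]
  set ρ : ℝ := s⁻¹ with hρ_def
  have hρ0 : 0 < ρ := inv_pos.mpr hs0
  have hρ1 : ρ < 1 := inv_lt_one_of_one_lt₀ hs1
  have hρinv : ρ⁻¹ = s := inv_inv s
  set t : ℝ := (1 + ρ) / 2 with ht_def
  have ht0 : 0 < t := by positivity
  have ht1 : t < 1 := by rw [ht_def]; linarith
  have hρt : ρ < t := by rw [ht_def]; linarith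
  -- the uniform bound `L` for the weighted partial sums of `x₁, x₂, g` at every embedding
  choose K₁ hK₁ using fun σ : E →+* ℂ ↦ hrx₁ σ t ht0 ht1
  choose K₂ hK₂ using fun σ : E →+* ℂ ↦ hrx₂ σ t ht0 ht1
  choose K₃ hK₃ using fun σ : E →+* ℂ ↦ hrg σ t ht0 ht1
  set L : ℝ := 1 + ∑ σ : E →+* ℂ, (|K₁ σ| + |K₂ σ| + |K₃ σ|) / (1 - ρ / t) with hL_def
  have hden : 0 < 1 - ρ / t := by
    rw [sub_pos, div_lt_one ht0]; exact hρt
  have hL1 : 1 ≤ L := by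
    rw [hL_def]
    refine le_add_of_nonneg_right (Finset.sum_nonneg fun σ _ ↦ by positivity)
  have hLbound : ∀ (σ : E →+* ℂ) (f : PowerSeries E) (K : ℝ),
      (∀ n, ‖σ (coeff n f)‖ * t ^ n ≤ K) → |K| ≤ |K₁ σ| + |K₂ σ| + |K₃ σ| →
      ∀ n, ∑ i ∈ range (n + 1), ‖coeff i (f.map σ)‖ * ρ ^ i ≤ L := by
    intro σ f K hKf hKle n
    have h1 : ∀ n, ‖coeff n (f.map σ)‖ * t ^ n ≤ |K| := fun n ↦ by
      rw [PowerSeries.coeff_map]; exact (hKf n).trans (le_abs_self K)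
    refine (weightedSum_le_of_radius hρ0.le ht0 hρt h1 n).trans ?_
    rw [hL_def]
    have h2 : |K| / (1 - ρ / t) ≤ (|K₁ σ| + |K₂ σ| + |K₃ σ|) / (1 - ρ / t) :=
      div_le_div_of_nonneg_right hKle hden.le
    refine h2.trans ?_
    refine le_trans ?_ (le_add_of_nonneg_left zero_le_one)
    exact Finset.single_le_sum (f := fun σ ↦ (|K₁ σ| + |K₂ σ| + |K₃ σ|) / (1 - ρ / t))
      (fun σ _ ↦ by positivity) (Finset.mem_univ σ)
  have hLx₁ : ∀ (σ : E →+* ℂ) n, ∑ i ∈ range (n + 1), ‖coeff i (x₁.map σ)‖ * ρ ^ i ≤ L :=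
    fun σ ↦ hLbound σ x₁ (K₁ σ) (hK₁ σ) (by linarith [abs_nonneg (K₂ σ), abs_nonneg (K₃ σ)])
  have hLx₂ : ∀ (σ : E →+* ℂ) n, ∑ i ∈ range (n + 1), ‖coeff i (x₂.map σ)‖ * ρ ^ i ≤ L :=
    fun σ ↦ hLbound σ x₂ (K₂ σ) (hK₂ σ) (by linarith [abs_nonneg (K₁ σ), abs_nonneg (K₃ σ)])
  have hLg : ∀ (σ : E →+* ℂ) n, ∑ i ∈ range (n + 1), ‖coeff i (g.map σ)‖ * ρ ^ i ≤ L :=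
    fun σ ↦ hLbound σ g (K₃ σ) (hK₃ σ) (by linarith [abs_nonneg (K₁ σ), abs_nonneg (K₂ σ)])
  set c₀ : ℕ := 13 + k₁ + k₂ with hc₀_def
  set Λ : ℝ := L ^ c₀ with hΛ_def
  have hΛ1 : 1 ≤ Λ := one_le_pow₀ hL1
  set CE : ℝ := Literature.NumberTheory.Transcendental.siegelConst E with hCE_def
  have hCE1 : 1 ≤ CE := Literature.NumberTheory.Transcendental.one_le_siegelConst E
  set Θ : ℝ := B ^ 2 * Λ ^ (2 * d) with hΘ_def
  have hΘ1 : 1 ≤ Θ := one_le_mul_of_one_le_of_one_le (one_le_pow₀ hB) (one_le_pow₀ hΛ1)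
  set K₀ : ℝ := A * CE ^ (2 * d) with hK₀_def
  have hK₀0 : 0 ≤ K₀ := by positivity
  /- ### choice of `D` -/
  obtain ⟨D, hD1, hDlt⟩ := exists_poly_mul_exp_lt_exp_sq hs1 hΘ1 hK₀0 (4 * d)
  /- ### the monomials and the auxiliary forms at bidegree `(D, D)` -/
  set mon : Fin (D + 1) → Fin (D + 1) → PowerSeries E := fun i j ↦
    x₁ ^ (i : ℕ) * x₂ ^ (D - i) * (g ^ 12 * x₂ ^ k₂) ^ (j : ℕ) * (x₂ ^ k₁) ^ (D - j) with hmon_def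
  have hFPmon : ∀ P : Fin (D + 1) → Fin (D + 1) → E,
      (∑ i : Fin (D + 1), ∑ j : Fin (D + 1),
          PowerSeries.C (P i j) * x₁ ^ (i : ℕ) * x₂ ^ (D - i) * (g ^ 12 * x₂ ^ k₂) ^ (j : ℕ) *
            (x₂ ^ k₁) ^ (D - j)) = ∑ i : Fin (D + 1), ∑ j : Fin (D + 1),
          PowerSeries.C (P i j) * mon i j := by
    intro P
    simp only [hmon_def, mul_assoc]
  -- integrality of the monomial coefficients
  have hmonint : ∀ i j n, IsIntegral ℤ (coeff n (mon i j)) := by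
    intro i j n
    simp only [hmon_def]
    refine isIntegral_coeff_mul (isIntegral_coeff_mul (isIntegral_coeff_mul
      (isIntegral_coeff_pow hx₁ _) (isIntegral_coeff_pow hx₂ _)) (isIntegral_coeff_pow
      (isIntegral_coeff_mul (isIntegral_coeff_pow hg 12) (isIntegral_coeff_pow hx₂ k₂)) _))
      (isIntegral_coeff_pow (isIntegral_coeff_pow hx₂ k₁) _) n
  -- the complex size of the monomial coefficients: `‖σ a_n(mon)‖ ≤ Λ^D s^n`
  have hmonC : ∀ (σ : E →+* ℂ) i j n, ‖σ (coeff n (mon i j))‖ ≤ Λ ^ D * s ^ n := by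
    intro σ i j n
    have hmap : (mon i j).map σ = (x₁.map σ) ^ (i : ℕ) * (x₂.map σ) ^ (D - i) *
        ((g.map σ) ^ 12 * (x₂.map σ) ^ k₂) ^ (j : ℕ) * ((x₂.map σ) ^ k₁) ^ (D - j) := by
      simp only [hmon_def, map_mul, map_pow]
    have hw := weightedSum_monomial_le hρ0.le hL1 (hLx₁ σ) (hLx₂ σ) (hLg σ) k₁ k₂ D i j
      (Nat.lt_succ_iff.mp i.isLt) (Nat.lt_succ_iff.mp j.isLt)
    rw [← hmap] at hw
    have := norm_coeff_le_of_weightedSum_le hρ0 hw n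
    rw [PowerSeries.coeff_map, hρinv] at this
    refine this.trans (le_of_eq ?_)
    rw [hΛ_def, ← pow_mul]
  /- ### Siegel's lemma at bidegree `(D, D)` -/
  set q : ℕ := (D + 1) ^ 2 with hq_def
  set Mr : ℕ := q / 2 with hMr_def
  have hq4 : 4 ≤ q := by rw [hq_def]; nlinarith
  have hMrq : Mr < q := by rw [hMr_def]; omega
  have h2Mr : 2 * Mr ≤ q := by rw [hMr_def]; omega
  have hq2Mr : q ≤ 2 * Mr + 1 := by rw [hMr_def]; omega
  have hMr0 : 0 < Mr := by rw [hMr_def]; omega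
  haveI : Nonempty (Fin (D + 1) × Fin (D + 1)) := ⟨(0, 0)⟩
  have hcardα : Fintype.card (Fin Mr) = Mr := Fintype.card_fin Mr
  have hcardβ : Fintype.card (Fin (D + 1) × Fin (D + 1)) = q := by
    rw [Fintype.card_prod, Fintype.card_fin, hq_def, sq]
  set aM : Matrix (Fin Mr) (Fin (D + 1) × Fin (D + 1)) (𝓞 E) :=
    fun m l ↦ ⟨coeff (m : ℕ) (mon l.1 l.2), hmonint l.1 l.2 m⟩ with haM_def
  set Ab : ℝ := Λ ^ D * s ^ Mr with hAb_def
  have hAb1 : 1 ≤ Ab := one_le_mul_of_one_le_of_one_le (one_le_pow₀ hΛ1) (one_le_pow₀ hs1.le)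
  have habs : ∀ m l, house (algebraMap (𝓞 E) E (aM m l)) ≤ Ab := by
    intro m l
    refine Literature.NumberTheory.Transcendental.SixExpPadic.house_le_of_forall_norm_le
      (zero_le_one.trans hAb1) fun σ ↦ ?_
    change ‖σ (coeff (m : ℕ) (mon l.1 l.2))‖ ≤ Ab
    refine (hmonC σ l.1 l.2 m).trans ?_
    exact mul_le_mul_of_nonneg_left (pow_le_pow_right₀ hs1.le (le_of_lt m.isLt)) (by positivity)
  obtain ⟨ξ, hξ0, hξmul, hξhouse⟩ := Literature.NumberTheory.Transcendental.siegel_house E aM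
    hMr0 hMrq hcardα hcardβ hAb1 habs
  -- the house bound, with the Dirichlet exponent `Mr/(q - Mr) ≤ 1` removed
  set Hs : ℝ := CE * (CE * q * Ab) with hHs_def
  have hq1 : (1 : ℝ) ≤ q := by exact_mod_cast (show 1 ≤ q by omega)
  have hbase : 1 ≤ CE * q * Ab :=
    one_le_mul_of_one_le_of_one_le (one_le_mul_of_one_le_of_one_le hCE1 hq1) hAb1
  have hHs1 : 1 ≤ Hs := one_le_mul_of_one_le_of_one_le hCE1 hbase
  have hHs : ∀ l, house ((ξ l : 𝓞 E) : E) ≤ Hs := by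
    intro l
    refine (hξhouse l).trans ?_
    rw [hHs_def]
    refine mul_le_mul_of_nonneg_left ?_ (zero_le_one.trans hCE1)
    have hexp : (Mr : ℝ) / (q - Mr) ≤ 1 := by
      have hlt : (Mr : ℝ) < q := by exact_mod_cast hMrq
      rw [div_le_one (by linarith)]
      have : ((2 * Mr : ℕ) : ℝ) ≤ q := by exact_mod_cast h2Mr
      push_cast at this
      linarith
    calc (CE * q * Ab) ^ ((Mr : ℝ) / (q - Mr)) ≤ (CE * q * Ab) ^ (1 : ℝ) :=
          Real.rpow_le_rpow_of_exponent_le hbase hexp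
      _ = CE * q * Ab := Real.rpow_one _
  /- ### the auxiliary polynomial `P` and its form `F_P` -/
  set P : Fin (D + 1) → Fin (D + 1) → E := fun i j ↦ ((ξ (i, j) : 𝓞 E) : E) with hP_def
  have hPint : ∀ i j, IsIntegral ℤ (P i j) := fun i j ↦ RingOfIntegers.isIntegral_coe _
  have hP0 : P ≠ 0 := by
    intro h
    apply hξ0
    funext l
    have h1 := congrFun (congrFun h l.1) l.2
    simp only [hP_def, Pi.zero_apply, Prod.mk.eta] at h1
    exact RingOfIntegers.coe_eq_zero_iff.mp h1
  set FP : PowerSeries E := ∑ i : Fin (D + 1), ∑ j : Fin (D + 1),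
    PowerSeries.C (P i j) * x₁ ^ (i : ℕ) * x₂ ^ (D - i) * (g ^ 12 * x₂ ^ k₂) ^ (j : ℕ) *
      (x₂ ^ k₁) ^ (D - j) with hFP_def
  have hcoeffFP : ∀ m, coeff m FP = ∑ i : Fin (D + 1), ∑ j : Fin (D + 1),
      P i j * coeff m (mon i j) := by
    intro m
    rw [hFP_def, hFPmon P]
    simp only [map_sum, PowerSeries.coeff_C_mul]
  -- `F_P` vanishes below `Mr` (the Siegel equations)
  have hvan : ∀ m, m < Mr → coeff m FP = 0 := by
    intro m hm
    rw [hcoeffFP]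
    have h := congrFun hξmul ⟨m, hm⟩
    rw [Pi.zero_apply, Matrix.mulVec, dotProduct] at h
    have h' := congrArg (algebraMap (𝓞 E) E) h
    rw [map_sum, map_zero, Fintype.sum_prod_type] at h'
    refine Eq.trans ?_ h'
    refine Finset.sum_congr rfl fun i _ ↦ Finset.sum_congr rfl fun j _ ↦ ?_
    rw [RingHom.map_mul (algebraMap (𝓞 E) E), mul_comm]
    rfl
  /- ### the leading coefficient `α` -/
  have hFP0 : FP ≠ 0 := H D D P hP0
  have hex : ∃ n, coeff n FP ≠ 0 := by
    by_contra hall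
    push Not at hall
    exact hFP0 (PowerSeries.ext fun n ↦ by simpa using hall n)
  set M' : ℕ := Nat.find hex with hM'_def
  have hM'ne : coeff M' FP ≠ 0 := Nat.find_spec hex
  have hM'min : ∀ m, m < M' → coeff m FP = 0 := fun m hm ↦ by
    have := Nat.find_min hex hm
    simpa using this
  have hMrM' : Mr ≤ M' := by
    by_contra hlt
    push Not at hlt
    exact hM'ne (hvan M' hlt)
  set α : E := coeff M' FP with hα_def
  have hαint : IsIntegral ℤ α := by
    rw [hα_def, hcoeffFP]
    exact IsIntegral.sum _ fun i _ ↦ IsIntegral.sum _ fun j _ ↦ (hPint i j).mul (hmonint i j M')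
  set αO : 𝓞 E := ⟨α, hαint⟩ with hαO_def
  have hαO0 : αO ≠ 0 := by
    intro h
    apply hM'ne
    have := congrArg ((↑) : 𝓞 E → E) h
    simpa [hαO_def] using this
  -- the `v`-adic gain at the vanishing order `M'`
  have hgainα : ‖v α‖ ≤ A * B ^ (D + D) * R⁻¹ ^ M' := hgain D D P hPint M' hM'min
  -- the archimedean sizes of `α`
  set Bnd : ℝ := CE ^ 2 * (q : ℝ) ^ 2 * Λ ^ (2 * D) * s ^ (2 * M') with hBnd_def
  have hBnd1 : 1 ≤ Bnd :=
    one_le_mul_of_one_le_of_one_le (one_le_mul_of_one_le_of_one_le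
      (one_le_mul_of_one_le_of_one_le (one_le_pow₀ hCE1) (one_le_pow₀ hq1)) (one_le_pow₀ hΛ1))
      (one_le_pow₀ hs1.le)
  have hσα : ∀ σ : E →+* ℂ, ‖σ α‖ ≤ Bnd := by
    intro σ
    rw [hα_def, hcoeffFP, map_sum]
    refine (norm_sum_le _ _).trans ?_
    have hij : ∀ i j, ‖σ (P i j * coeff M' (mon i j))‖ ≤ Hs * (Λ ^ D * s ^ M') := by
      intro i j
      rw [map_mul, norm_mul]
      exact mul_le_mul ((norm_embedding_le_house _ σ).trans (hHs (i, j))) (hmonC σ i j M')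
        (norm_nonneg _) (zero_le_one.trans hHs1)
    calc ∑ i, ‖σ (∑ j, P i j * coeff M' (mon i j))‖
        ≤ ∑ i, ∑ j, ‖σ (P i j * coeff M' (mon i j))‖ :=
          Finset.sum_le_sum fun i _ ↦ by rw [map_sum]; exact norm_sum_le _ _
      _ ≤ ∑ _i : Fin (D + 1), ∑ _j : Fin (D + 1), Hs * (Λ ^ D * s ^ M') :=
          Finset.sum_le_sum fun i _ ↦ Finset.sum_le_sum fun j _ ↦ hij i j
      _ = CE ^ 2 * (q : ℝ) ^ 2 * Λ ^ (2 * D) * s ^ (Mr + M') := by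
          simp only [Finset.sum_const, Finset.card_univ, Fintype.card_fin]
          rw [hHs_def, hAb_def, hq_def]
          push_cast
          ring
      _ ≤ Bnd := by
          rw [hBnd_def]
          exact mul_le_mul_of_nonneg_left (pow_le_pow_right₀ hs1.le (by omega)) (by positivity)
  -- the `𝔭`-adic Liouville inequality
  have hLiou := Literature.NumberTheory.Transcendental.SixExpPadic.liouville_padic (ℓ := p)
    (E := PadicAlgCl p) v hαO0 hBnd1 hσα
  change (Bnd ^ d)⁻¹ ≤ ‖v α‖ at hLiou
  /- ### the contradiction -/
  have hBnd0 : 0 < Bnd := zero_lt_one.trans_le hBnd1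
  have hRM : 0 < R ^ M' := pow_pos hR0 M'
  have h1 : R ^ M' ≤ A * B ^ (D + D) * Bnd ^ d := by
    have h := hLiou.trans hgainα
    rw [inv_pow, ← one_div, ← div_eq_mul_inv, div_le_div_iff₀ (pow_pos hBnd0 d) hRM, one_mul] at h
    exact h
  -- rewrite in terms of `s`: `R^{M'} = s^{2dM'} s^{2dM'}`, `Bnd^d = Y^d s^{2dM'}`
  set Y : ℝ := CE ^ 2 * (q : ℝ) ^ 2 * Λ ^ (2 * D) with hY_def
  have hBndY : Bnd = Y * s ^ (2 * M') := by rw [hBnd_def, hY_def]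
  have hsplit : R ^ M' = s ^ (2 * d * M') * s ^ (2 * d * M') := by
    rw [← hsR, ← pow_mul, ← pow_add]
    ring_nf
  have h2 : s ^ (2 * d * M') ≤ A * B ^ (D + D) * Y ^ d := by
    have hpos : 0 < s ^ (2 * d * M') := pow_pos hs0 _
    refine le_of_mul_le_mul_right ?_ hpos
    calc s ^ (2 * d * M') * s ^ (2 * d * M') = R ^ M' := hsplit.symm
      _ ≤ A * B ^ (D + D) * Bnd ^ d := h1
      _ = A * B ^ (D + D) * Y ^ d * s ^ (2 * d * M') := by
          rw [hBndY, mul_pow, ← pow_mul]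
          ring_nf
  have h3 : s ^ (D ^ 2) ≤ s ^ (2 * d * M') := by
    refine pow_le_pow_right₀ hs1.le ?_
    have hD2 : D ^ 2 + 1 ≤ q := by rw [hq_def]; nlinarith
    have : D ^ 2 ≤ 2 * M' := by omega
    calc D ^ 2 ≤ 2 * M' := this
      _ = 2 * 1 * M' := by ring
      _ ≤ 2 * d * M' := by gcongr
  have hYeq : Y = CE ^ 2 * Λ ^ (2 * D) * ((D : ℝ) + 1) ^ 4 := by
    rw [hY_def, hq_def]
    push_cast
    ring
  have hYd : Y ^ d = CE ^ (2 * d) * Λ ^ (2 * d * D) * ((D : ℝ) + 1) ^ (4 * d) := by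
    rw [hYeq, mul_pow, mul_pow, ← pow_mul CE 2 d, ← pow_mul Λ (2 * D) d,
      ← pow_mul ((D : ℝ) + 1) 4 d, show 2 * D * d = 2 * d * D by ring]
  have h4 : A * B ^ (D + D) * Y ^ d = K₀ * ((D : ℝ) + 1) ^ (4 * d) * Θ ^ D := by
    rw [hYd, hK₀_def, hΘ_def]
    ring
  have := (h3.trans h2).trans_eq h4
  exact absurd hDlt (not_lt.mpr this)

end Summit.Langlands.Langlands.Theorems.CapacityClassicality

end
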